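import Summits.BirchSwinnertonDyer.BirchSwinnertonDyer.Theorems.EisensteinPrimesMazurMCOnCellBEtaleEndAtP
import Summits.BirchSwinnertonDyer.Rank1Residual.X2.TateLineDecomposition
import Literature.NumberTheory.GaloisRepresentations.DecompositionGroupOfCompletion
import Literature.NumberTheory.EllipticCurves.StrictSelmerRankOne
import Summits.BirchSwinnertonDyer.Rank1Residual.X11b.LocalTorsionMultiplicative
import Mathlib.NumberTheory.Padics.HeightOneSpectrum
import HarnessLib

/-!
# Crux `MazurMCOnCellB` (stmt-BirchSwinnertonDyer-19033), line `mudescent` v4 — the LOCAL SPLITTING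
# `E₀[p]|_{D_p} = Φ ⊕ X₀` at the étale end, and the local `p`-torsion there: `E₀(ℚ_p)[p] ≠ 0 ⟺ p` split

Width seat bsd-line-x2-p1-w2 (gen 5), `--supports -19033`, μ-lineage (stub 3′ `stub_muPart_offLocus`
of `mudescent` v4 lives AT THE ÉTALE END `(W₀, p)`: `X2.CellB W₀ p ∧ ¬ HasRamifiedOddLineAt W₀ p`,
where every rational `p`-line is unramified-even). THEOREMS ONLY (no definition, no named fact, no
`sorry`); nothing here proves a main conjecture, closes a stub or moves a label. Continues
`…MazurMCOnCellBEtaleEndAtP` (gen 4); sequel `…MazurMCOnCellBEtaleEndCube` (`p = 3`, `Δ_min ∈ (ℚ₃^×)³`).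
Setting: `W/ℚ` globally minimal, `p` ODD of MULTIPLICATIVE reduction, `Φ ≤ E[p]` a rational `p`-line
UNRAMIFIED at `p`, `v ∋ p`, `D_v ≥ I_v` the tree's `GreenbergSelmer.decomp` / `.inertia`.

* §1 `exists_tateLine_compl_of_lineUnramifiedAt_of_mult` — **THE LOCAL SPLITTING**: the Tate `μ`-line
  `X₀ = C ∩ E[p]` of the twisted Tate datum (A41, DISCHARGED
  `TateCurve.Silverman1994_thmV53_corV54_tateUniformisation_holds`; `#X₀ = p`, `D_v`-stable, a point of
  it MOVED by `I_v`) meets `Φ` trivially, `E[p] = Φ ⊕ X₀`, and `D_v` acts on `E[p]/X₀ ≅ Φ` through a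
  sign `s(g) = ±1` (the unramified quadratic character). I.e. `0 → μ_p ⊗ δ → E[p] → 𝔽_p(δ) → 0`
  SPLITS as `G_p`-modules at an unramified rational line (Kummer: `q_E ∈ (ℚ_p^×)^p`; Silverman
  *ATAEC* §V.6 Prop. 6.1: `E_q[p] = ⟨φ(ζ), φ(q^{1/p})⟩`).
* §2 `smul_eq_or_eq_neg_of_lineUnramifiedAt_of_mult` (`D_v` acts on `Φ` by `±1`: `φ|_{G_p} ∈ {1, δ}`),
  `smul_smul_eq_of_mem_of_lineUnramifiedAt_of_mult` (`g² = 1` on `Φ`), and at `p = 3`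
  `smul_smul_eq_of_lineUnramifiedAt_three`: **`ρ̄_{E,3}(D_3)` has exponent `2`** (`Aut(ℤ/3) = {±1}`
  on both lines).
* §3 local `p`-torsion at the X2b étale end (any odd `p`): **split ⟹ `E₀(ℚ_p)[p] ≠ 0`**
  (`exists_localTorsion_ne_zero_of_cellB_offLocus_of_split`: Galois descent of a point of `Φ` fixed by
  `D_v`; so hypothesis (iv) «`E(ℚ_p)[p] = 0`» of the torsion-free control theorems — Castella 2018
  erratum Thm. 1.1 (iv), tree `X11b.LocalTorsion.localTorsion_eq_zero_of_mult` — FAILS at every split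
  étale end), the dichotomy `exists_localTorsion_ne_zero_iff_split_of_cellB_offLocus`
  (**`E₀(ℚ_p)[p] ≠ 0 ⟺ p` split**), and `eq_zero_of_forall_decomp_smul_eq_of_cellB_offLocus_of_not_split`
  (non-split: `E₀[p]^{D_v} = 0`).

HONEST FRAMING: structure of the étale end only; stub 3′ (`μ_an ≤ μ_alg` there) stays OPEN class-wide
(Vatsal, J. Inst. Math. Jussieu 4 (2005) Thm. 1.16 and p. 11); no summit statement, no main
conjecture / BSD for any curve is proved here; 0 cells / labels move.
References: [GreenbergVatsal2000] §2 pp. 14–15; [SilvermanATAEC1994] V.5.2 (c), V.5.3, V.5.4, §V.6 Prop.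
6.1 (PDF pp. 410–411); [NeukirchANT1999] II (9.6); [Castella2018Erratum] Thm. 1.1 (iv); [SilvermanAEC2009] VII.6.1.
-/

set_option autoImplicit false

-- `Summit.BirchSwinnertonDyer.BirchSwinnertonDyer.…`: the summit and its single sub-problem share a name (D-0017 layout).
set_option linter.dupNamespace false

noncomputable section

open scoped Classical NumberField

open WeierstrassCurve NumberField IsDedekindDomain Field
  Literature.NumberTheory.EllipticCurves
  Literature.NumberTheory.EllipticCurves.Rank1Residual
  Literature.NumberTheory.GaloisRepresentations
  Literature.NumberTheory.EllipticCurves.GreenbergSelmer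
  Literature.Barriers.BirchSwinnertonDyer
  Summit.BirchSwinnertonDyer.Rank1Residual
  Summit.BirchSwinnertonDyer.Rank1Residual.X2.GreenbergVatsalTateDatum
  Summit.BirchSwinnertonDyer.Rank1Residual.X2.GreenbergVatsalTateDatumSign
  Summit.BirchSwinnertonDyer.Rank1Residual.X2.GreenbergVatsalTateDatumTorsion
  Summit.BirchSwinnertonDyer.Rank1Residual.X2.GreenbergVatsalTateDatumCofree
  Summit.BirchSwinnertonDyer.Rank1Residual.X2.TateLineDecomposition

namespace Summit.BirchSwinnertonDyer.BirchSwinnertonDyer.Theorems.EisensteinPrimesMazurMCOnCellBEtaleEndLocalSplitting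

variable {W : WeierstrassCurve ℚ} [W.IsElliptic] [W.IsGloballyMinimal] {p : ℕ} [hp : Fact p.Prime]

/-! ## §1 The local splitting `E[p]|_{D_v} = Φ ⊕ X₀` at a multiplicative odd `p`, `Φ` unramified -/

omit [W.IsElliptic] [W.IsGloballyMinimal] in
/-- The tree's inertia group `I_v ≤ Γ_ℚ` (`GreenbergSelmer.inertia v` = inertia group of the prime
`𝔓₀ = adicCompletionPrime ℚ v` above `v`, tree `inertia_adicCompletionPrime_eq_map_absInertia`) fixes an
unramified rational line pointwise. [cite: NeukirchANT1999, Ch. II §9 Prop. (9.6)] -/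
theorem smul_eq_of_mem_inertia_of_lineUnramifiedAt {Φ : AddSubgroup (geomTorsion W (p : ℤ))}
    (hunr : LineUnramifiedAt W p Φ) {v : HeightOneSpectrum (𝓞 ℚ)} (hpv : (p : 𝓞 ℚ) ∈ v.asIdeal)
    {τ : absoluteGaloisGroup ℚ} (hτ : τ ∈ inertia (K := ℚ) v) {P : geomTorsion W (p : ℤ)}
    (hP : P ∈ Φ) : τ • P = P := by
  have hτ' : τ ∈ (adicCompletionPrime ℚ v).inertia (absoluteGaloisGroup ℚ) := by
    rw [inertia_adicCompletionPrime_eq_map_absInertia]; exact hτ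
  exact hunr v hpv _ (adicCompletionPrime_mem_primesAbove ℚ v) τ hτ' P hP

omit [W.IsElliptic] [W.IsGloballyMinimal] in
/-- In a subgroup `A ≤ E[p]` of order `p`, every element is a multiple of any non-zero element
(`A` is cyclic of prime order). [folklore] -/
theorem exists_nsmul_eq_of_mem_of_ne_zero {A : AddSubgroup (geomTorsion W (p : ℤ))}
    (hA : Nat.card A = p) {R : geomTorsion W (p : ℤ)} (hR : R ∈ A) (hR0 : R ≠ 0)
    {Q : geomTorsion W (p : ℤ)} (hQ : Q ∈ A) : ∃ n < p, n • R = Q := by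
  have hpp : p.Prime := hp.out
  -- `⟨R⟩ = A`
  have hle : AddSubgroup.zmultiples R ≤ A := AddSubgroup.zmultiples_le_of_mem hR
  have hord : addOrderOf R ∣ p := addOrderOf_dvd_of_nsmul_eq_zero (AddSubgroup.torsionBy.nsmul R)
  have hord1 : addOrderOf R ≠ 1 := by rw [Ne, AddMonoid.addOrderOf_eq_one_iff]; exact hR0
  have hordp : addOrderOf R = p := ((Nat.dvd_prime hpp).mp hord).resolve_left hord1
  have hcard : Nat.card (AddSubgroup.zmultiples R) = p := by rw [Nat.card_zmultiples, hordp]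
  haveI : Finite A := Nat.finite_of_card_ne_zero (by rw [hA]; exact hpp.ne_zero)
  have heq : AddSubgroup.zmultiples R = A := AddSubgroup.eq_of_le_of_card_ge hle (by rw [hA, hcard])
  obtain ⟨k, hk⟩ := AddSubgroup.mem_zmultiples_iff.mp (heq ▸ hQ : Q ∈ AddSubgroup.zmultiples R)
  -- reduce the integer `k` modulo `p`
  have hk0 : 0 ≤ k % p := Int.emod_nonneg _ (by exact_mod_cast hpp.ne_zero)
  refine ⟨(k % p).toNat, ?_, ?_⟩
  · have hlt : k % p < p := Int.emod_lt_of_pos _ (by exact_mod_cast hpp.pos)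
    omega
  have e : ((k % p).toNat : ℤ) • R = k • R := by
    rw [Int.toNat_of_nonneg hk0]
    have hpR : (p : ℤ) • R = 0 := by rw [natCast_zsmul]; exact AddSubgroup.torsionBy.nsmul R
    conv_rhs => rw [← Int.emod_add_mul_ediv k p, add_zsmul, mul_comm, mul_zsmul, hpR, zsmul_zero,
      add_zero]
  rw [← natCast_zsmul, e, hk]


omit [W.IsGloballyMinimal] in
/-- Two subgroups of order `p` of `E[p]` meeting trivially span it (the sum map `Φ × X → E[p]` is
injective between sets of `p²` elements, tree `natCard_geomTorsion`). [folklore] -/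
theorem exists_add_eq_of_inf_eq_bot {Φ X : AddSubgroup (geomTorsion W (p : ℤ))}
    (hΦ : Nat.card Φ = p) (hX : Nat.card X = p) (hbot : Φ ⊓ X = ⊥) (P : geomTorsion W (p : ℤ)) :
    ∃ P₁ ∈ Φ, ∃ P₂ ∈ X, P = P₁ + P₂ := by
  have hpp : p.Prime := hp.out
  haveI : Finite (geomTorsion W (p : ℤ)) := Nat.finite_of_card_ne_zero
    (by rw [Rank1Residual.natCard_geomTorsion W p]; exact pow_ne_zero 2 hpp.ne_zero)
  let f : Φ × X → geomTorsion W (p : ℤ) := fun ab ↦ (ab.1 : geomTorsion W (p : ℤ)) + ab.2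
  have hinj : Function.Injective f := by
    rintro ⟨⟨a, ha⟩, ⟨b, hb⟩⟩ ⟨⟨a', ha'⟩, ⟨b', hb'⟩⟩ h
    have h' : a + b = a' + b' := h
    have hmem : a - a' ∈ Φ ⊓ X := by
      refine ⟨Φ.sub_mem ha ha', ?_⟩
      have e : a - a' = b' - b := sub_eq_sub_iff_add_eq_add.mpr (h'.trans (add_comm _ _))
      rw [e]; exact X.sub_mem hb' hb
    rw [hbot, AddSubgroup.mem_bot, sub_eq_zero] at hmem
    subst hmem
    obtain rfl : b = b' := add_left_cancel h'
    rfl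
  have hcard : Nat.card (geomTorsion W (p : ℤ)) ≤ Nat.card (Φ × X) := by
    rw [Nat.card_prod, hΦ, hX, Rank1Residual.natCard_geomTorsion W p, pow_two]
  obtain ⟨⟨⟨a, ha⟩, ⟨b, hb⟩⟩, hab⟩ := (hinj.bijective_of_nat_card_le hcard).2 P
  exact ⟨a, ha, b, hb, hab.symm⟩

/-- **THE LOCAL SPLITTING `E[p]|_{D_v} = Φ ⊕ X₀` at a multiplicative odd `p` with an UNRAMIFIED
rational line.** For `W/ℚ` globally minimal, `p` odd multiplicative, `Φ ≤ E[p]` a rational `p`-line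
unramified at `p`, `v ∋ p`: there is `X₀ ≤ E[p]` of order `p` — the Tate `μ`-line `C ∩ E[p]` of the
twisted Tate datum (A41 DISCHARGED `TateCurve.Silverman1994_thmV53_corV54_tateUniformisation_holds`;
`natCard_tateDatum_plus_inf_torsionBy`) — `D_v`-stable, meeting `Φ` trivially, with `E[p] = Φ + X₀`, a
point MOVED by `I_v` (so `X₀` is THE ramified line), and `D_v` acting on `E[p]/X₀` through a sign
`s(g) = ±1` (`g • P − s(g) • P ∈ X₀`). GV: `E[p]|_{G_p}` is an extension of `𝔽_p(δ)` by `μ_p ⊗ δ`;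
AT AN UNRAMIFIED RATIONAL LINE IT SPLITS (Kummer: the class of `q_E` in `ℚ_p^×/(ℚ_p^×)^p` dies).
[cite: GreenbergVatsal2000, §2 pp. 14–15] [cite: SilvermanATAEC1994, Ch. V Lemma 5.2 (c), Thm. 5.3, Cor. 5.4]
[cite: NeukirchANT1999, Ch. II §9 Prop. (9.6)] -/
theorem exists_tateLine_compl_of_lineUnramifiedAt_of_mult (hp2 : p ≠ 2)
    (hmult : W.HasMultiplicativeReductionAtPrime p)
    {Φ : AddSubgroup (geomTorsion W (p : ℤ))} (hΦ : IsRationalLine W p Φ)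
    (hunr : LineUnramifiedAt W p Φ) {v : HeightOneSpectrum (𝓞 ℚ)} (hpv : (p : 𝓞 ℚ) ∈ v.asIdeal) :
    ∃ X : AddSubgroup (geomTorsion W (p : ℤ)), Nat.card X = p ∧
      (∀ g ∈ decomp (K := ℚ) v, ∀ P ∈ X, g • P ∈ X) ∧
      Φ ⊓ X = ⊥ ∧
      (∀ P : geomTorsion W (p : ℤ), ∃ P₁ ∈ Φ, ∃ P₂ ∈ X, P = P₁ + P₂) ∧
      (∃ τ ∈ inertia (K := ℚ) v, ∃ Q ∈ X, τ • Q ≠ Q) ∧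
      (∀ g ∈ decomp (K := ℚ) v, ∃ s : ℤ, (s = 1 ∨ s = -1) ∧
        ∀ P : geomTorsion W (p : ℤ), g • P - s • P ∈ X) := by
  have hpp := hp.out
  -- the twisted Tate parametrisation above `v` (A41, discharged)
  obtain ⟨q, t, Ψ, hq0, hq1, ht0, ht2, hsurj, hker, hΨσ, -⟩ :=
    TateCurve.Silverman1994_thmV53_corV54_tateUniformisation_holds W v
      (X2.GreenbergVatsalStrictSelmerMultiplicative.hasMultiplicativeReductionAt_of_mem W p hmult hpv)
  have hker' : ∀ u : (AlgebraicClosure (v.adicCompletion ℚ))ˣ, Ψ (Additive.ofMul u) = 0 →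
      ∃ a : ℤ, (u : AlgebraicClosure (v.adicCompletion ℚ)) =
        algebraMap (v.adicCompletion ℚ) (AlgebraicClosure (v.adicCompletion ℚ)) q ^ a :=
    fun u h ↦ (hker u).1 h
  have hΨI : ∀ σ ∈ absInertia (v.adicCompletion ℚ),
      ∀ u : (AlgebraicClosure (v.adicCompletion ℚ))ˣ,
      σ • Ψ (Additive.ofMul u) = Ψ (Additive.ofMul (Units.map
        (Field.absoluteGaloisGroup.toAlgEquiv (v.adicCompletion ℚ) σ :
          AlgebraicClosure (v.adicCompletion ℚ) →* AlgebraicClosure (v.adicCompletion ℚ)) u)) := by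
    intro σ hσ u
    rw [hΨσ σ u,
      if_pos (X2.GreenbergVatsalTateDatumRat.inertia_fix_sqrt_gamma W hp2 hmult hpv t ht2 σ hσ),
      one_zsmul]
  set N := tateDatum W p Ψ (sign_disj W Ψ t hΨσ) with hN
  set X := N.plus.comap (AddSubgroup.inclusion (geomTorsion_le_geomPrimaryTorsion W p)) with hXdef
  have hXcard : Nat.card X = p := by
    rw [hXdef, natCard_comap_eq W p N, hN]
    exact natCard_tateDatum_plus_inf_torsionBy W p Ψ _ hq0 hq1 hker'
  haveI hXfin : Finite X := Nat.finite_of_card_ne_zero (by rw [hXcard]; exact hpp.ne_zero)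
  have hXst : ∀ g ∈ decomp (K := ℚ) v, ∀ P ∈ X, g • P ∈ X := fun g hg P hP ↦
    smul_mem_comap_of_mem_decomp W p N hg hP
  -- the inertia group moves a point of `X₀`
  haveI : Nontrivial X := Finite.one_lt_card_iff_nontrivial.mp (by rw [hXcard]; exact hpp.one_lt)
  obtain ⟨⟨P₁, hP₁X⟩, hP₁0⟩ := exists_ne (0 : X)
  have hP₁0' : P₁ ≠ 0 := fun h ↦ hP₁0 (Subtype.ext h)
  obtain ⟨τ, hτ, Q, hQX, hτQ⟩ := exists_mem_inertia_smul_ne_of_hgen W p N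
    (tateDatum_hgen W p Ψ _ hq0 hq1 hker' hΨI hp2 hpv) hP₁X hP₁0'
  -- `Φ ⊓ X₀ = ⊥`: otherwise `Φ = X₀` and `τ ∈ I_v` would fix `Q` (the line is unramified)
  have hΦX : Φ ⊓ X = ⊥ := by
    rcases inf_eq_bot_or_eq W p hΦ.1 hXcard with hbot | heq
    · exact hbot
    · exact absurd (smul_eq_of_mem_inertia_of_lineUnramifiedAt hunr hpv hτ (heq ▸ hQX)) hτQ
  -- `D_v` acts on `E[p]/X₀` through the sign `s(σ) = [σ √γ = √γ] − [σ √γ ≠ √γ]`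
  have hsign : ∀ g ∈ decomp (K := ℚ) v, ∃ s : ℤ, (s = 1 ∨ s = -1) ∧
      ∀ P : geomTorsion W (p : ℤ), g • P - s • P ∈ X := by
    rintro g ⟨σ, rfl⟩
    refine ⟨if Field.absoluteGaloisGroup.toAlgEquiv (v.adicCompletion ℚ) σ t = t then 1 else -1,
      by split_ifs <;> simp, fun P ↦ ?_⟩
    exact smul_sub_zsmul_mem_comap W p N
      (fun m ↦ smul_sub_sign_smul_mem W p Ψ t hΨσ hsurj hker' σ m) P
  exact ⟨X, hXcard, hXst, hΦX, exists_add_eq_of_inf_eq_bot hΦ.1 hXcard hΦX, ⟨τ, hτ, Q, hQX, hτQ⟩,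
    hsign⟩

/-! ## §2 `D_v` acts on the unramified line through a sign; at `p = 3`, `ρ̄(D_v)` has exponent `2` -/

/-- **`D_v` acts on an UNRAMIFIED rational line through a SIGN** (`φ|_{G_p} ∈ {1, δ}`: each `g ∈ D_v`
is `+1` or `−1` on `Φ ≅ E[p]/X₀`; `+1` throughout iff `p` split, cf. `…EtaleEndAtP.decomp_fix_of_offLocus_of_split`
/ `.not_decomp_fix_of_not_split`). [cite: GreenbergVatsal2000, §2 pp. 14–15]
[cite: SilvermanATAEC1994, Ch. V Lemma 5.2 (c), Thm. 5.3, Cor. 5.4] -/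
theorem smul_eq_or_eq_neg_of_lineUnramifiedAt_of_mult (hp2 : p ≠ 2)
    (hmult : W.HasMultiplicativeReductionAtPrime p)
    {Φ : AddSubgroup (geomTorsion W (p : ℤ))} (hΦ : IsRationalLine W p Φ)
    (hunr : LineUnramifiedAt W p Φ) {v : HeightOneSpectrum (𝓞 ℚ)} (hpv : (p : 𝓞 ℚ) ∈ v.asIdeal)
    {g : absoluteGaloisGroup ℚ} (hg : g ∈ decomp (K := ℚ) v) :
    (∀ P ∈ Φ, g • P = P) ∨ (∀ P ∈ Φ, g • P = -P) := by
  obtain ⟨X, -, -, hΦX, -, -, hsign⟩ :=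
    exists_tateLine_compl_of_lineUnramifiedAt_of_mult hp2 hmult hΦ hunr hpv
  obtain ⟨s, hs, hgs⟩ := hsign g hg
  have key : ∀ P ∈ Φ, g • P = s • P := fun P hP ↦ by
    have hmem : g • P - s • P ∈ Φ ⊓ X := ⟨Φ.sub_mem (hΦ.2 g P hP) (Φ.zsmul_mem hP s), hgs P⟩
    rw [hΦX, AddSubgroup.mem_bot, sub_eq_zero] at hmem
    exact hmem
  rcases hs with rfl | rfl
  · exact Or.inl fun P hP ↦ by rw [key P hP, one_zsmul]
  · exact Or.inr fun P hP ↦ by rw [key P hP, neg_one_zsmul]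

/-- **Every `g ∈ D_v` acts as an involution on an unramified rational line** (`g² = 1` on `Φ`,
any odd multiplicative `p`). [cite: GreenbergVatsal2000, §2 pp. 14–15] -/
theorem smul_smul_eq_of_mem_of_lineUnramifiedAt_of_mult (hp2 : p ≠ 2)
    (hmult : W.HasMultiplicativeReductionAtPrime p)
    {Φ : AddSubgroup (geomTorsion W (p : ℤ))} (hΦ : IsRationalLine W p Φ)
    (hunr : LineUnramifiedAt W p Φ) {v : HeightOneSpectrum (𝓞 ℚ)} (hpv : (p : 𝓞 ℚ) ∈ v.asIdeal)
    {g : absoluteGaloisGroup ℚ} (hg : g ∈ decomp (K := ℚ) v) {P : geomTorsion W (p : ℤ)}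
    (hP : P ∈ Φ) : g • g • P = P := by
  rcases smul_eq_or_eq_neg_of_lineUnramifiedAt_of_mult hp2 hmult hΦ hunr hpv hg with h | h
  · rw [h P hP, h P hP]
  · rw [h P hP, smul_neg, h P hP, neg_neg]

/-- **At `p = 3` the image of `D_v` in `Aut(E₀[3]) ≅ GL₂(𝔽₃)` has exponent `2`**: with multiplicative
reduction at `3` and a rational `3`-line UNRAMIFIED at `3`, every `g ∈ D_v` (`v ∋ 3`) satisfies
`g • g • P = P` on `E₀[3] = Φ ⊕ X₀` (`Aut(ℤ/3) = {±1}` on each line; ON the locus `E₀[3]|_{D_v}` is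
non-split and `D_v` contains transvections, Silverman *ATAEC* V.6.1).
[cite: GreenbergVatsal2000, §2 pp. 14–15] [cite: SilvermanATAEC1994, Ch. V Thm. 5.3, Cor. 5.4, §V.6 Prop. 6.1] -/
theorem smul_smul_eq_of_lineUnramifiedAt_three {W : WeierstrassCurve ℚ} [W.IsElliptic]
    [W.IsGloballyMinimal] (hmult : W.HasMultiplicativeReductionAtPrime 3)
    {Φ : AddSubgroup (geomTorsion W ((3 : ℕ) : ℤ))} (hΦ : IsRationalLine W 3 Φ)
    (hunr : LineUnramifiedAt W 3 Φ) {v : HeightOneSpectrum (𝓞 ℚ)}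
    (hpv : ((3 : ℕ) : 𝓞 ℚ) ∈ v.asIdeal) {g : absoluteGaloisGroup ℚ} (hg : g ∈ decomp (K := ℚ) v)
    (P : geomTorsion W ((3 : ℕ) : ℤ)) : g • g • P = P := by
  have h32 : (3 : ℕ) ≠ 2 := by decide
  obtain ⟨X, hXcard, hXst, hΦX, hsum, -, -⟩ :=
    exists_tateLine_compl_of_lineUnramifiedAt_of_mult h32 hmult hΦ hunr hpv
  obtain ⟨P₁, hP₁, P₂, hP₂, rfl⟩ := hsum P
  have h1 : g • g • P₁ = P₁ := smul_smul_eq_of_mem_of_lineUnramifiedAt_of_mult h32 hmult hΦ hunr hpv hg hP₁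
  -- on the `D_v`-stable line `X₀` of order `3`, `g` acts as `±1`
  have h2 : g • g • P₂ = P₂ := by
    by_cases hP₂0 : P₂ = 0
    · rw [hP₂0, smul_zero, smul_zero]
    obtain ⟨n, hn3, hn⟩ := exists_nsmul_eq_of_mem_of_ne_zero hXcard hP₂ hP₂0 (hXst g hg P₂ hP₂)
    have h3 : (3 : ℕ) • P₂ = 0 := AddSubgroup.torsionBy.nsmul P₂
    interval_cases n
    · rw [zero_smul] at hn
      exact absurd ((smul_eq_zero_iff_eq g).mp hn.symm) hP₂0
    · rw [one_smul] at hn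
      rw [← hn, ← hn]
    · have e : g • g • P₂ = (2 : ℕ) • P₂ + (2 : ℕ) • P₂ := by
        conv_lhs => rw [← hn, two_nsmul, smul_add, ← hn]
      rw [e, ← add_nsmul, show (2 + 2 : ℕ) = 1 + 3 from rfl, add_nsmul, one_nsmul, h3, add_zero]
  rw [smul_add, smul_add, h1, h2]


/-! ## §3 Local `p`-torsion at the étale end: `E₀(ℚ_p)[p] ≠ 0` iff `p` is SPLIT -/

/-- **At a SPLIT X2b étale end `E₀(ℚ_v)[p] ≠ 0`** (`v ∋ p`): `D_v` fixes the rational line pointwise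
(`…EtaleEndAtP.decomp_fix_of_offLocus_of_split`), so a non-zero point of `Φ`, carried to `E₀(ℚ̄_v)`,
is `Γ_{ℚ_v}`-fixed and descends to `E₀(ℚ_v)` (tree `exists_map_eq_of_forall_smul_localPoints_eq`).
[cite: GreenbergVatsal2000, §2 pp. 14–15] [cite: SilvermanATAEC1994, §V.5 Thm. 5.3] -/
theorem exists_point_adicCompletion_ne_zero_of_cellB_offLocus_of_split (hc : X2.CellB W p)
    (hoff : ¬ HasRamifiedOddLineAt W p) (hsplit : W.HasSplitMultiplicativeReductionAtPrime p)
    {v : HeightOneSpectrum (𝓞 ℚ)} (hpv : (p : 𝓞 ℚ) ∈ v.asIdeal) :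
    ∃ R : (W.baseChange (v.adicCompletion ℚ)).toAffine.Point, R ≠ 0 ∧ p • R = 0 := by
  obtain ⟨Φ, hΦ⟩ := exists_isRationalLine_of_not_irr W p hc.2.1.2.1
  have hfix := EisensteinPrimesMazurMCOnCellBEtaleEndAtP.decomp_fix_of_offLocus_of_split hc hoff
    hsplit hΦ hpv
  obtain ⟨P₀, hP₀Φ, hP₀0⟩ :=
    EisensteinPrimesMazurMCOnCellBEtaleEndAtP.exists_ne_zero_of_isRationalLine hΦ
  -- the image `Q` of `P₀` in `E(ℚ̄_v)` is fixed by `Γ_{ℚ_v}` and killed by `p`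
  set Q : localPoints W (v.adicCompletion ℚ) :=
    pointsMap W (v.adicCompletion ℚ) (P₀ : W.geomPoints) with hQ
  have hQfix : ∀ τ : absoluteGaloisGroup (v.adicCompletion ℚ), τ • Q = Q := fun τ ↦ by
    have hmem : absGaloisRestrict ℚ (v.adicCompletion ℚ) τ ∈ decomp (K := ℚ) v := by
      rw [mem_decomp_iff]; exact ⟨τ, rfl⟩
    have h1 : absGaloisRestrict ℚ (v.adicCompletion ℚ) τ • P₀ = P₀ := hfix _ hmem P₀ hP₀Φ
    rw [hQ, ← pointsMap_smul, resGal_eq_absGaloisRestrict]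
    exact congrArg _ (congrArg Subtype.val h1)
  have hQ0 : Q ≠ 0 := fun h ↦ hP₀0 (by
    apply Subtype.ext
    exact pointsMapOfEmb_injective W _ (h.trans (map_zero _).symm))
  have hQp : p • Q = 0 := by
    rw [hQ, ← map_nsmul, ← AddSubmonoidClass.coe_nsmul, AddSubgroup.torsionBy.nsmul P₀,
      ZeroMemClass.coe_zero, map_zero]
  -- Galois descent to `E(ℚ_v)` (`ℚ_v` is perfect: characteristic zero)
  haveI : PerfectField (v.adicCompletion ℚ) :=
    @PerfectField.ofCharZero _ _ (charZero_adicCompletion v)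
  obtain ⟨R, hR⟩ := exists_map_eq_of_forall_smul_localPoints_eq W (v.adicCompletion ℚ) hQfix
  refine ⟨R, by rintro rfl; exact hQ0 (hR.symm.trans (map_zero _)), ?_⟩
  · apply WeierstrassCurve.Affine.Point.map_injective
      (f := IsScalarTower.toAlgHom ℚ (v.adicCompletion ℚ) (AlgebraicClosure (v.adicCompletion ℚ)))
    rw [map_nsmul, hR, map_zero]
    exact hQp

/-- **At a SPLIT X2b étale end `E₀(ℚ_p)[p] ≠ 0`** (`ℚ_p`-point form, Mathlib `Padic.adicCompletionEquiv`):
hypothesis (iv) «`E(ℚ_p)[p] = 0`» of the torsion-free control theorems (Castella 2018 erratum Thm. 1.1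
(iv); tree `X11b.LocalTorsion.localTorsion_eq_zero_of_mult`, sub-row `¬split ∨ p ∤ v_p(Δ_min)`) FAILS
at every split étale end (`q_E ∈ (ℚ_p^×)^p` there). [cite: GreenbergVatsal2000, §2 pp. 14–15]
[cite: Castella2018Erratum, Thm. 1.1 (iv) and Remark (pp. 1–2)] [cite: SilvermanATAEC1994, §V.5 Thm. 5.3] -/
theorem exists_localTorsion_ne_zero_of_cellB_offLocus_of_split (hc : X2.CellB W p)
    (hoff : ¬ HasRamifiedOddLineAt W p) (hsplit : W.HasSplitMultiplicativeReductionAtPrime p) :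
    ∃ R : (W.baseChange ℚ_[p]).toAffine.Point, R ≠ 0 ∧ p • R = 0 := by
  obtain ⟨R, hR0, hRp⟩ := exists_point_adicCompletion_ne_zero_of_cellB_offLocus_of_split hc hoff
    hsplit (KernelDisc.natCast_mem_asIdeal_primesEquiv_symm (p := p))
  -- transport along `ℚ_v ≃ ℚ_p`
  let e : ((Rat.HeightOneSpectrum.primesEquiv (R := 𝓞 ℚ)).symm ⟨p, Fact.out⟩).adicCompletion ℚ
      →ₐ[ℚ] ℚ_[p] :=
    ((Padic.adicCompletionEquiv (R := 𝓞 ℚ) ⟨p, Fact.out⟩).toAlgEquiv.symm :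
      ((Rat.HeightOneSpectrum.primesEquiv (R := 𝓞 ℚ)).symm ⟨p, Fact.out⟩).adicCompletion ℚ
        ≃ₐ[ℚ] ℚ_[p])
  refine ⟨WeierstrassCurve.Affine.Point.map e R, fun h ↦ hR0 ?_, ?_⟩
  · exact WeierstrassCurve.Affine.Point.map_injective (f := e) (h.trans (map_zero _).symm)
  · rw [← map_nsmul, hRp, map_zero]

/-- **The local `p`-torsion DICHOTOMY at an X2b étale end: `E₀(ℚ_p)[p] ≠ 0 ⟺ p` is SPLIT.**
`⟸` is the previous theorem; `⟹`: at a non-split multiplicative `p ≥ 3` every `E/ℚ` has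
`E(ℚ_p)[p] = 0` (tree `X11b.LocalTorsion.localTorsion_eq_zero_of_nonsplit`, Silverman VII.6.1).
[cite: SilvermanAEC2009, Thm VII.6.1 and Exercise 3.5] [cite: GreenbergVatsal2000, §2 pp. 14–15] -/
theorem exists_localTorsion_ne_zero_iff_split_of_cellB_offLocus (hc : X2.CellB W p)
    (hoff : ¬ HasRamifiedOddLineAt W p) :
    (∃ R : (W.baseChange ℚ_[p]).toAffine.Point, R ≠ 0 ∧ p • R = 0) ↔
      W.HasSplitMultiplicativeReductionAtPrime p := by
  refine ⟨fun ⟨R, hR0, hRp⟩ ↦ ?_, exists_localTorsion_ne_zero_of_cellB_offLocus_of_split hc hoff⟩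
  by_contra hns
  have hp3 : 3 ≤ p := lt_of_le_of_ne hp.out.two_le (Ne.symm hc.2.1.1)
  exact hR0 (X11b.LocalTorsion.localTorsion_eq_zero_of_nonsplit W p hp3 hc.2.1.2.2 hns R hRp)

/-- **NON-SPLIT étale end: `E₀[p]^{D_v} = 0`**: a `D_v`-fixed point has fixed components `P₁ ∈ Φ`,
`P₂ ∈ X₀`; `I_v ≤ D_v` moves the line `X₀` and, `p` being non-split, `D_v` moves `Φ`
(`…EtaleEndAtP.not_decomp_fix_of_not_split`), so both vanish (a line of prime order fixed at a non-zero
point is fixed pointwise). The `ℚ_p`-point form is the tree's `X11b.LocalTorsion.localTorsion_eq_zero_of_nonsplit`.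
[cite: GreenbergVatsal2000, §2 pp. 14–15] [cite: SilvermanATAEC1994, Ch. V Lemma 5.2 (c), Cor. 5.4] -/
theorem eq_zero_of_forall_decomp_smul_eq_of_cellB_offLocus_of_not_split (hc : X2.CellB W p)
    (hoff : ¬ HasRamifiedOddLineAt W p) (hns : ¬ W.HasSplitMultiplicativeReductionAtPrime p)
    {v : HeightOneSpectrum (𝓞 ℚ)} (hpv : (p : 𝓞 ℚ) ∈ v.asIdeal) {P : geomTorsion W (p : ℤ)}
    (hP : ∀ g ∈ decomp (K := ℚ) v, g • P = P) : P = 0 := by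
  have hp2 : p ≠ 2 := hc.2.1.1
  have hmult : W.HasMultiplicativeReductionAtPrime p := hc.2.1.2.2
  obtain ⟨Φ, hΦ⟩ := exists_isRationalLine_of_not_irr W p hc.2.1.2.1
  have hunr : LineUnramifiedAt W p Φ :=
    (EisensteinPrimesMazurMCOnCellBEtaleEndAtP.lineUnramifiedAt_of_offLocus hc.2.2 hoff hΦ).1
  obtain ⟨X, hXcard, hXst, hΦX, hsum, ⟨τ, hτ, Q, hQX, hτQ⟩, -⟩ :=
    exists_tateLine_compl_of_lineUnramifiedAt_of_mult hp2 hmult hΦ hunr hpv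
  obtain ⟨P₁, hP₁, P₂, hP₂, rfl⟩ := hsum P
  -- both components are fixed by `D_v`
  have hcomp : ∀ g ∈ decomp (K := ℚ) v, g • P₁ = P₁ ∧ g • P₂ = P₂ := fun g hg ↦ by
    have h := hP g hg
    rw [smul_add] at h
    have hmem : g • P₁ - P₁ ∈ Φ ⊓ X := by
      refine ⟨Φ.sub_mem (hΦ.2 g P₁ hP₁) hP₁, ?_⟩
      have e : g • P₁ - P₁ = P₂ - g • P₂ := by rw [sub_eq_sub_iff_add_eq_add, h, add_comm]
      rw [e]; exact X.sub_mem hP₂ (hXst g hg P₂ hP₂)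
    rw [hΦX, AddSubgroup.mem_bot, sub_eq_zero] at hmem
    refine ⟨hmem, ?_⟩
    rw [hmem] at h
    exact add_left_cancel h
  -- `P₂ = 0`: otherwise the inertia element `τ ∈ I_v ≤ D_v` would fix `Q = n • P₂`
  have hP₂0 : P₂ = 0 := by
    by_contra hne
    obtain ⟨n, -, hn⟩ := exists_nsmul_eq_of_mem_of_ne_zero hXcard hP₂ hne hQX
    exact hτQ (by rw [← hn, smul_comm, (hcomp τ (inertia_le_decomp v hτ)).2])
  -- `P₁ = 0`: otherwise `D_v` would fix `Φ = ⟨P₁⟩` pointwise, impossible at a non-split `p`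
  have hP₁0 : P₁ = 0 := by
    by_contra hne
    refine EisensteinPrimesMazurMCOnCellBEtaleEndAtP.not_decomp_fix_of_not_split hc hns hΦ hpv
      fun g hg R hR ↦ ?_
    obtain ⟨n, -, hn⟩ := exists_nsmul_eq_of_mem_of_ne_zero hΦ.1 hP₁ hne hR
    rw [← hn, smul_comm, (hcomp g hg).1]
  rw [hP₁0, hP₂0, add_zero]

end Summit.BirchSwinnertonDyer.BirchSwinnertonDyer.Theorems.EisensteinPrimesMazurMCOnCellBEtaleEndLocalSplitting

end
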